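import Summits.AtomisticToContinuum.Crystallization.Theorems.FreeSplittingCertificatesStrictSplittingRuleDefs

/-!
# `FiniteRangeSplitting` (stmt-AtomisticToContinuum-12559): counting the first coordination shell by angle

Support file for crux r2 of route `FreeSplittingCertificates` (block-2b unit `b2b-freesplit-A`, gen 13).
VALUE = a geometric counting lemma feeding the layer cake of `…RadiusLadderHalfRule54` — NOT summit progress.

* `two_tsq_mul_le_of_thin_shell` / `inner_dir_le_of_thin_shell` — THIN-SHELL ANGLE LEMMA: if two points of a
  `δ`-separated set lie at distances in `[δ, t]` from a centre and the shell is thin, `t(t − δ) ≤ δ²` (i.e.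
  `t ≤ φ·δ`, `φ` the golden ratio), then their directions from the centre have inner product `≤ 1 − δ²/(2t²)`
  (the extremal case is two points on the outer sphere at mutual distance `δ`).
* `card_near_le_of_angular` — hence, for a `δ`-separated configuration, the number of neighbours of a site at
  distance `< t` is bounded by any bound `D` for unit vectors with pairwise inner products `≤ 1 − δ²/(2t²)` — the
  Delsarte menu of `…RadiusLadderDelsarte` (`card_le_14_of_inner_le`, …).  At `δ = 5/4` this replaces the volume
  count `(2t/δ + 1)³ − 1 ∈ [28, 50]` of `…RadiusLadderPacking` by `14, 15, 17, …, 46` on the shells `t ≤ 1.70`.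
-/

noncomputable section

namespace Summit.AtomisticToContinuum.Crystallization.Theorems.StrictSplittingRuleBirth

open scoped BigOperators Classical

/-! ## The thin-shell angle lemma -/

/-- Scalar core: for `δ ≤ r, r' ≤ t`, `t(t − δ) ≤ δ²` and `δ² ≤ r² + r'² − 2q` (the law of cosines with
`q = ⟪x − p, x' − p⟫`), one has `2t²·q ≤ (2t² − δ²)·r r'`. -/
theorem two_tsq_mul_le_of_thin_shell {δ t r r' q : ℝ} (hδ : 0 < δ) (hthin : t * (t - δ) ≤ δ ^ 2)
    (hr : δ ≤ r) (hrt : r ≤ t) (hr' : δ ≤ r') (hr't : r' ≤ t) (hq : δ ^ 2 ≤ r ^ 2 + r' ^ 2 - 2 * q) :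
    2 * t ^ 2 * q ≤ (2 * t ^ 2 - δ ^ 2) * (r * r') := by
  -- it suffices to show `t²(r − r')² ≤ δ²(t² − r r')`
  suffices key : t ^ 2 * (r - r') ^ 2 ≤ δ ^ 2 * (t ^ 2 - r * r') by nlinarith
  have ht : 0 < t := lt_of_lt_of_le hδ (hr.trans hrt)
  rcases le_total r' r with h | h
  · -- `r' ≤ r`: compare with the outer point `t − r'`
    have hb : t * (t - r') ≤ δ ^ 2 := by nlinarith
    have h1 : (r - r') ^ 2 ≤ (t - r') ^ 2 := by nlinarith
    have h2 : t ^ 2 * (t - r') ^ 2 ≤ δ ^ 2 * (t * (t - r')) := by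
      have : 0 ≤ t * (t - r') := by nlinarith
      nlinarith
    have h3 : t * (t - r') ≤ t ^ 2 - r * r' := by nlinarith
    have hδ2 : 0 ≤ δ ^ 2 := sq_nonneg δ
    nlinarith [mul_le_mul_of_nonneg_left h3 hδ2, mul_le_mul_of_nonneg_left h1 (sq_nonneg t)]
  · -- `r ≤ r'`: symmetric
    have hb : t * (t - r) ≤ δ ^ 2 := by nlinarith
    have h1 : (r - r') ^ 2 ≤ (t - r) ^ 2 := by nlinarith
    have h2 : t ^ 2 * (t - r) ^ 2 ≤ δ ^ 2 * (t * (t - r)) := by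
      have : 0 ≤ t * (t - r) := by nlinarith
      nlinarith
    have h3 : t * (t - r) ≤ t ^ 2 - r * r' := by nlinarith
    have hδ2 : 0 ≤ δ ^ 2 := sq_nonneg δ
    nlinarith [mul_le_mul_of_nonneg_left h3 hδ2, mul_le_mul_of_nonneg_left h1 (sq_nonneg t)]

/-- The direction `‖x − p‖⁻¹ • (x − p)` of `x` seen from `p` is a unit vector (away from the centre). -/
theorem norm_dir_eq_one {p x : EuclideanSpace ℝ (Fin 3)} (h : 0 < dist x p) : ‖(dist x p)⁻¹ • (x - p)‖ = 1 := by
  rw [norm_smul, norm_inv, Real.norm_eq_abs, abs_of_pos h, ← dist_eq_norm, inv_mul_cancel₀ h.ne']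

/-- **Thin-shell angle lemma**: two `δ`-separated points at distances in `[δ, t]` from `p`, with `t(t − δ) ≤ δ²`,
have directions with inner product `≤ 1 − δ²/(2t²)`. -/
theorem inner_dir_le_of_thin_shell {δ t : ℝ} (hδ : 0 < δ) (hthin : t * (t - δ) ≤ δ ^ 2)
    {p x x' : EuclideanSpace ℝ (Fin 3)} (hx : δ ≤ dist x p) (hxt : dist x p ≤ t) (hx' : δ ≤ dist x' p)
    (hx't : dist x' p ≤ t) (hxx' : δ ≤ dist x x') :
    inner ℝ ((dist x p)⁻¹ • (x - p)) ((dist x' p)⁻¹ • (x' - p)) ≤ 1 - δ ^ 2 / (2 * t ^ 2) := by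
  set r := dist x p with hr_def
  set r' := dist x' p with hr'_def
  have hr0 : 0 < r := hδ.trans_le hx
  have hr'0 : 0 < r' := hδ.trans_le hx'
  have ht : 0 < t := hr0.trans_le hxt
  -- law of cosines
  have hq : δ ^ 2 ≤ r ^ 2 + r' ^ 2 - 2 * inner ℝ (x - p) (x' - p) := by
    have e : dist x x' ^ 2 = r ^ 2 + r' ^ 2 - 2 * inner ℝ (x - p) (x' - p) := by
      have : x - x' = (x - p) - (x' - p) := by abel
      rw [dist_eq_norm, this, norm_sub_sq_real, hr_def, hr'_def, dist_eq_norm, dist_eq_norm]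
      ring
    rw [← e]
    exact pow_le_pow_left₀ hδ.le hxx' 2
  have key := two_tsq_mul_le_of_thin_shell hδ hthin hx hxt hx' hx't hq
  -- normalise
  have e : inner ℝ (r⁻¹ • (x - p)) (r'⁻¹ • (x' - p)) = (r * r')⁻¹ * inner ℝ (x - p) (x' - p) := by
    rw [real_inner_smul_left, real_inner_smul_right, mul_inv]
    ring
  rw [e]
  have hrr' : 0 < r * r' := mul_pos hr0 hr'0
  rw [inv_mul_le_iff₀ hrr']
  -- goal: `⟪x−p, x'−p⟫ ≤ (r r') (1 − δ²/(2t²))`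
  have h2t : (0 : ℝ) < 2 * t ^ 2 := by positivity
  have : r * r' * (1 - δ ^ 2 / (2 * t ^ 2)) = (2 * t ^ 2 - δ ^ 2) * (r * r') / (2 * t ^ 2) := by
    field_simp
  rw [this, le_div_iff₀ h2t]
  linarith

/-! ## Counting a shell by angle -/

/-- **Angular shell count.**  For a `δ`-separated configuration `x` and a thin radius `t` (`t(t − δ) ≤ δ²`), any
bound `D` on the size of spherical codes with pairwise inner products `≤ 1 − δ²/(2t²)` bounds the number of
neighbours of a site at distance `< t`. -/
theorem card_near_le_of_angular {δ t : ℝ} (hδ : 0 < δ) (hthin : t * (t - δ) ≤ δ ^ 2) {N : ℕ} (D : ℕ)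
    (hD : ∀ (s : Finset (Fin N)) (u : Fin N → EuclideanSpace ℝ (Fin 3)), (∀ j ∈ s, ‖u j‖ = 1) →
      (∀ j ∈ s, ∀ j' ∈ s, j ≠ j' → inner ℝ (u j) (u j') ≤ 1 - δ ^ 2 / (2 * t ^ 2)) → s.card ≤ D)
    {x : Fin N → EuclideanSpace ℝ (Fin 3)} (hx : Sep δ x) (i : Fin N) :
    ((Finset.univ.erase i).filter fun j => dist (x i) (x j) < t).card ≤ D := by
  set s := (Finset.univ.erase i).filter fun j => dist (x i) (x j) < t with hs
  have hmem : ∀ j ∈ s, j ≠ i ∧ dist (x j) (x i) < t := fun j hj => by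
    rw [hs, Finset.mem_filter] at hj
    exact ⟨Finset.ne_of_mem_erase hj.1, by rw [dist_comm]; exact hj.2⟩
  have hfar : ∀ j ∈ s, δ ≤ dist (x j) (x i) := fun j hj => hx j i (hmem j hj).1
  refine hD s (fun j => (dist (x j) (x i))⁻¹ • (x j - x i)) (fun j hj => norm_dir_eq_one (hδ.trans_le (hfar j hj))) ?_
  intro j hj j' hj' hne
  exact inner_dir_le_of_thin_shell hδ hthin (hfar j hj) (hmem j hj).2.le (hfar j' hj') (hmem j' hj').2.le
    (hx j j' hne)

/-- The same with a real-valued right-hand side, in the shape consumed by the layer cake. -/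
theorem card_near_le_of_angular' {δ t : ℝ} (hδ : 0 < δ) (hthin : t * (t - δ) ≤ δ ^ 2) {N : ℕ} (D : ℕ)
    (hD : ∀ (s : Finset (Fin N)) (u : Fin N → EuclideanSpace ℝ (Fin 3)), (∀ j ∈ s, ‖u j‖ = 1) →
      (∀ j ∈ s, ∀ j' ∈ s, j ≠ j' → inner ℝ (u j) (u j') ≤ 1 - δ ^ 2 / (2 * t ^ 2)) → s.card ≤ D)
    {x : Fin N → EuclideanSpace ℝ (Fin 3)} (hx : Sep δ x) (i : Fin N) :
    ((((Finset.univ.erase i).filter fun j => dist (x i) (x j) < t).card : ℕ) : ℝ) ≤ D := by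
  exact_mod_cast card_near_le_of_angular hδ hthin D hD hx i

end Summit.AtomisticToContinuum.Crystallization.Theorems.StrictSplittingRuleBirth

end
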